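import Summits.MatrixMultiplication.MatrixMultiplication.Theorems.FarEdgeDescentTowerDeviation
import HarnessLib

/-!
# Far-edge descent, kernel XXXI: the analytic half of the IMPROVABLE squaring tower (order `0.70951…`)

Route `FarEdgeDescent`, special leaf `FiniteSaturation` (stmt-MatrixMultiplication-23739): helper
kernel, THESES-FREE and def-free.  Kernels XXIX–XXX-C exhausted the CRUDE full-class tower
(re-anchoring costs one leg: `r' = r^N + L'`; limit order `0.44860…` at clock `7`).  Pan's
IMPROVABLE realisations (Pan 1984 §16, Props. 16.2–16.5; Stothers 2010 Thm. 8; Knuth TAOCP 2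
§4.6.4 Ex. 67(c),(g); tree: `algBorderRank_innerAugment_le_of_improvable` for ONE augmentation)
re-anchor cost-free at the price of two legs of anchor: clock `2`, `r' = r²`, `L' = (Q+L)² − Q²`,
`Q' = r² − 2L'` (so `Q + 2L = r` throughout), legs ratio `m' = (1−m)² − (1−2m)² = m(2−3m) ≤ 1/3`,
virtual recursion `γ' = (θ+γ)² − θ²` with deviation multiplier `2(1−m) ≥ 4/3` — NO box analysis is
needed.  Iterating improvability through tensor squares needs a Literature DEFINITION of the class
of improvable approximate realisations (not in the tree; blocked for this seat), so this file proves
the ANALYTIC HALF as an interface theorem: IF a numeric chain `(r_j, Q_j, L_j, G_j)` with the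
improvable recursion satisfies the virtual readout `G_j(s,t) ≤ r_j` on every sub-tangent `(s,t)` of
`y ↦ ω(1,y,1)` (the virtual τ-theorem of kernel XXVIII applied to the stage-`j` tensor), THEN
`s − 1 ≤ C(1−t)^κ` with `κ = log₂(4/3)` (`virtualPowerBound_of_improvableChain`), hence
`RateBeyond θ` for every `θ < κ/(1−κ) = log(4/3)/log(3/2) = 0.70951…`
(`rateBeyond_of_improvableChain`; certified floor `7/10`, `(4/3)^17 > 2^7`).  What remains for
`0.70951` is the CONSTRUCTION of such a chain (Pan's improvable squaring, one definition + one
chain kernel like XXX-A); nothing in this file asserts that it exists.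

References: Pan 1984 (LNCS 179) §16 (Def. 16.1, Props. 16.2–16.5), §17 Thm. 17.1; Stothers 2010,
Thm. 8; Knuth TAOCP 2, §4.6.4 Ex. 67; Lotti–Romani 1983, Thm. 3.1, Prop. 4.1; Coppersmith–Winograd 1982.
Tags: `FiniteSaturation` (h₁) NEC · WEAKER-CONDITIONAL (rate `0.70951⁻` modulo the improvable chain).
-/

set_option linter.dupNamespace false

noncomputable section

open scoped BigOperators

namespace Summit.MatrixMultiplication.MatrixMultiplication.Theorems.FarEdgeDescentImprovableDynamics

open Literature.Computability.AlgebraicComplexity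
open Summit.MatrixMultiplication.MatrixMultiplication.Theorems.FarEdgeDescentTowerDeviation

variable (K : Type) [Field K]

/-! ## §1 One improvable stage: algebra of the deviation -/

/-- **Improvable deviation step.**  With `θ ≤ 1 − 2m` (deficit `(1−2m) − θ ≥ 0`), `m ≤ 1/3`,
`m ≤ γ ≤ 1`: `(θ+γ)² − θ² − ((1−m)² − (1−2m)²) ≥ (4/3)(γ − m) − 2((1−2m) − θ)`. [folklore] -/
theorem improvable_deviation_step {m θ γ : ℝ} (hm3 : m ≤ 1 / 3)
    (hθρ : θ ≤ 1 - 2 * m) (hγm : m ≤ γ) (hγ1 : γ ≤ 1) :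
    4 / 3 * (γ - m) - 2 * ((1 - 2 * m) - θ) ≤
      ((θ + γ) ^ 2 - θ ^ 2) - ((1 - m) ^ 2 - (1 - 2 * m) ^ 2) := by
  have key : ((θ + γ) ^ 2 - θ ^ 2) - ((1 - m) ^ 2 - (1 - 2 * m) ^ 2) =
      (γ - m) * (2 * θ + γ + m) - 2 * ((1 - 2 * m) - θ) * m := by ring
  rw [key]
  have hD : 0 ≤ γ - m := by linarith
  have hdef : 0 ≤ (1 - 2 * m) - θ := by linarith
  have h1 : (γ - m) * (2 * (1 - m) - 2 * ((1 - 2 * m) - θ)) ≤ (γ - m) * (2 * θ + γ + m) :=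
    mul_le_mul_of_nonneg_left (by linarith) hD
  have h2 : 4 / 3 * (γ - m) ≤ 2 * (1 - m) * (γ - m) := by nlinarith
  nlinarith

/-- `1 − Q^(t−1) ≤ (1−t)·log r` and the anchor deficit `(Q/r)(1 − Q^(t−1)) ≤ (1−t) log r` for
`1 ≤ Q ≤ r`, `t ≤ 1`. [folklore] -/
theorem anchor_deficit_le {Q r t : ℝ} (hQ : 1 ≤ Q) (hQr : Q ≤ r) (ht : t ≤ 1) :
    Q / r - Q ^ t / r ≤ (1 - t) * Real.log r := by
  have hQpos : 0 < Q := by linarith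
  have hrpos : 0 < r := by linarith
  have hsplit : Q ^ t = Q * Q ^ (t - 1) := by
    rw [show t = (t - 1) + 1 by ring, Real.rpow_add_one hQpos.ne', add_sub_cancel_right]; ring
  have h1 : 1 - Q ^ (t - 1) ≤ (1 - t) * Real.log Q := one_sub_rpow_le_mul_log hQ
  have h2 : Real.log Q ≤ Real.log r := Real.log_le_log hQpos hQr
  have h3 : Q ^ (t - 1) ≤ 1 := Real.rpow_le_one_of_one_le_of_nonpos hQ (by linarith)
  have hu : 0 ≤ 1 - t := by linarith
  have e : Q / r - Q ^ t / r = Q / r * (1 - Q ^ (t - 1)) := by rw [hsplit]; ring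
  rw [e]
  have hQr1 : Q / r ≤ 1 := by rw [div_le_one hrpos]; exact hQr
  have hQr0 : 0 ≤ Q / r := by positivity
  calc Q / r * (1 - Q ^ (t - 1)) ≤ 1 * (1 - Q ^ (t - 1)) :=
        mul_le_mul_of_nonneg_right hQr1 (by linarith)
    _ ≤ (1 - t) * Real.log Q := by linarith
    _ ≤ (1 - t) * Real.log r := mul_le_mul_of_nonneg_left h2 hu

/-! ## §2 The improvable chain: normal forms -/

section Chain

variable (r Q L : ℕ → ℕ) (G : ℕ → ℝ → ℝ → ℝ)

/-- `r_j = r₀^(2^j)`, hence `log r_j = 2^j log r₀`. [folklore] -/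
theorem r_eq_pow (hr : ∀ j, r (j + 1) = r j ^ 2) : ∀ j, r j = r 0 ^ (2 ^ j) := by
  intro j
  induction j with
  | zero => simp
  | succ j ih => rw [hr, ih, ← pow_mul, pow_succ]

/-- **Ratio normal form** of an improvable stage: `r_j > 0`, `0 ≤ m_j ≤ 1/3`,
`1 − 2m_j = Q_j/r_j`, `1 − m_j = (Q_j+L_j)/r_j`, and `m_{j+1} = (1−m_j)² − (1−2m_j)²`. [folklore] -/
theorem improvable_normalForm (hsum : ∀ j, Q j + 2 * L j = r j) (hQ1 : ∀ j, 1 ≤ Q j)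
    (hm0 : 3 * L 0 ≤ r 0) (hL : ∀ j, L (j + 1) = (Q j + L j) ^ 2 - Q j ^ 2)
    (hr : ∀ j, r (j + 1) = r j ^ 2) (j : ℕ) :
    (0 : ℝ) < r j ∧ 0 ≤ (L j : ℝ) / r j ∧ (L j : ℝ) / r j ≤ 1 / 3 ∧
      1 - 2 * ((L j : ℝ) / r j) = (Q j : ℝ) / r j ∧
      (L (j + 1) : ℝ) / r (j + 1) = (1 - (L j : ℝ) / r j) ^ 2 - (1 - 2 * ((L j : ℝ) / r j)) ^ 2 := by
  have hrposN : ∀ i, 0 < r i := fun i => by have := hsum i; have := hQ1 i; omega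
  have hrpos : ∀ i, (0 : ℝ) < r i := fun i => by exact_mod_cast hrposN i
  have hsumR : ∀ i, (Q i : ℝ) + 2 * L i = r i := fun i => by exact_mod_cast hsum i
  have hrec : ∀ i, (L (i + 1) : ℝ) / r (i + 1) =
      (1 - (L i : ℝ) / r i) ^ 2 - (1 - 2 * ((L i : ℝ) / r i)) ^ 2 := by
    intro i
    have hle : Q i ^ 2 ≤ (Q i + L i) ^ 2 := Nat.pow_le_pow_left (by omega) 2
    have hLR : (L (i + 1) : ℝ) = ((Q i : ℝ) + L i) ^ 2 - (Q i : ℝ) ^ 2 := by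
      rw [hL i]; push_cast [Nat.cast_sub hle]; ring
    have hrR : (r (i + 1) : ℝ) = (r i : ℝ) ^ 2 := by rw [hr i]; push_cast; ring
    rw [hLR, hrR]
    have hri := hrpos i
    have e1 : 1 - (L i : ℝ) / r i = ((Q i : ℝ) + L i) / r i := by
      field_simp; linarith [hsumR i]
    have e2 : 1 - 2 * ((L i : ℝ) / r i) = (Q i : ℝ) / r i := by
      field_simp; linarith [hsumR i]
    rw [e1, e2]
    field_simp
  -- m_j ≤ 1/3 for all j
  have hthird : ∀ i, (L i : ℝ) / r i ≤ 1 / 3 := by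
    intro i
    induction i with
    | zero =>
      rw [div_le_iff₀ (hrpos 0)]
      have : (3 : ℝ) * L 0 ≤ r 0 := by exact_mod_cast hm0
      linarith
    | succ i ih =>
      rw [hrec i]
      nlinarith [sq_nonneg ((L i : ℝ) / r i - 1 / 3)]
  refine ⟨hrpos j, by positivity, hthird j, ?_, hrec j⟩
  have hrj := hrpos j
  field_simp
  linarith [hsumR j]

/-- **Virtual normal form** of an improvable stage on a sub-tangent `(s,t)`: `θ_j = Q_j^t/r_j ∈
[0, 1−2m_j]`, deficit `(1−2m_j) − θ_j ≤ (1−t)·2^j·log r₀`, `0 ≤ γ_j ≤ 1`, and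
`γ_{j+1} = (θ_j+γ_j)² − θ_j²`. [folklore] -/
theorem improvable_virtualForm (hsum : ∀ j, Q j + 2 * L j = r j) (hQ1 : ∀ j, 1 ≤ Q j)
    (hm0 : 3 * L 0 ≤ r 0) (hL : ∀ j, L (j + 1) = (Q j + L j) ^ 2 - Q j ^ 2)
    (hr : ∀ j, r (j + 1) = r j ^ 2) (hG0 : ∀ s t : ℝ, 0 ≤ G 0 s t)
    (hG : ∀ j (s t : ℝ), G (j + 1) s t = (((Q j : ℕ) : ℝ) ^ t + G j s t) ^ 2 - (((Q j : ℕ) : ℝ) ^ t) ^ 2)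
    (hread : ∀ j (s t : ℝ), (∀ y : ℝ, 0 ≤ y → s + y * t ≤ omegaRect K 1 y 1) → G j s t ≤ r j)
    {s t : ℝ} (ht1 : t ≤ 1) (hst : ∀ y : ℝ, 0 ≤ y → s + y * t ≤ omegaRect K 1 y 1) (j : ℕ) :
    0 ≤ ((Q j : ℕ) : ℝ) ^ t / r j ∧ ((Q j : ℕ) : ℝ) ^ t / r j ≤ 1 - 2 * ((L j : ℝ) / r j) ∧
      (1 - 2 * ((L j : ℝ) / r j)) - ((Q j : ℕ) : ℝ) ^ t / r j ≤ (1 - t) * (2 ^ j * Real.log (r 0)) ∧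
      0 ≤ G j s t / r j ∧ G j s t / r j ≤ 1 ∧
      G (j + 1) s t / r (j + 1) = (((Q j : ℕ) : ℝ) ^ t / r j + G j s t / r j) ^ 2 -
        (((Q j : ℕ) : ℝ) ^ t / r j) ^ 2 := by
  obtain ⟨hrpos, hm0', -, hρ, -⟩ := improvable_normalForm r Q L hsum hQ1 hm0 hL hr j
  have hQ1R : (1 : ℝ) ≤ ((Q j : ℕ) : ℝ) := by exact_mod_cast hQ1 j
  have hQr : ((Q j : ℕ) : ℝ) ≤ r j := by
    have := hsum j; exact_mod_cast (show Q j ≤ r j by omega)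
  have hQt0 : 0 ≤ ((Q j : ℕ) : ℝ) ^ t := Real.rpow_nonneg (by linarith) t
  have hQt1 : ((Q j : ℕ) : ℝ) ^ t ≤ ((Q j : ℕ) : ℝ) := by
    have h := Real.rpow_le_rpow_of_exponent_le hQ1R ht1
    rwa [Real.rpow_one] at h
  have hGn : ∀ i, 0 ≤ G i s t := by
    intro i
    induction i with
    | zero => exact hG0 s t
    | succ i ih =>
      rw [hG]
      have hq : 0 ≤ ((Q i : ℕ) : ℝ) ^ t := Real.rpow_nonneg (Nat.cast_nonneg _) t
      nlinarith
  refine ⟨by positivity, ?_, ?_, div_nonneg (hGn j) hrpos.le, ?_, ?_⟩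
  · rw [hρ]; exact div_le_div_of_nonneg_right hQt1 hrpos.le
  · rw [hρ]
    have h := anchor_deficit_le (t := t) hQ1R hQr ht1
    have hlog : Real.log (r j : ℝ) = 2 ^ j * Real.log (r 0) := by
      rw [r_eq_pow r hr j]; push_cast; rw [Real.log_pow]; push_cast; ring
    rw [hlog] at h
    exact h
  · rw [div_le_one hrpos]; exact hread j s t hst
  · have hrR : (r (j + 1) : ℝ) = (r j : ℝ) ^ 2 := by rw [hr j]; push_cast; ring
    rw [hG, hrR]
    field_simp

/-! ## §3 The deviation induction -/

/-- **Core bound (improvable chain).**  On a sub-tangent `(s,t)` with initial deviation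
`≥ c(s−1)`: for every `n` with `(1−t)·2ⁿ·log r₀ ≤ 1/6`, `(4/3)ⁿ·c(s−1) < 2` — else the deviation,
multiplied by `≥ 4/3` per stage with losses `≤ 2·(deficit)`, exceeds `1 ≥ γ_n − m_n` at stage `n`.
[cite: Pan1984, Props. 16.2–16.5, Thm. 17.1; Stothers2010, Thm. 8; LottiRomani1983, Thm. 3.1] -/
theorem core_bound_improvable (hsum : ∀ j, Q j + 2 * L j = r j) (hQ1 : ∀ j, 1 ≤ Q j)
    (hm0 : 3 * L 0 ≤ r 0) (hL : ∀ j, L (j + 1) = (Q j + L j) ^ 2 - Q j ^ 2)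
    (hr : ∀ j, r (j + 1) = r j ^ 2) (hG0 : ∀ s t : ℝ, 0 ≤ G 0 s t)
    (hG : ∀ j (s t : ℝ), G (j + 1) s t = (((Q j : ℕ) : ℝ) ^ t + G j s t) ^ 2 - (((Q j : ℕ) : ℝ) ^ t) ^ 2)
    (hread : ∀ j (s t : ℝ), (∀ y : ℝ, 0 ≤ y → s + y * t ≤ omegaRect K 1 y 1) → G j s t ≤ r j)
    {c : ℝ} {s t : ℝ} (ht1 : t ≤ 1) (hst : ∀ y : ℝ, 0 ≤ y → s + y * t ≤ omegaRect K 1 y 1)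
    (hD0 : c * (s - 1) ≤ G 0 s t / r 0 - (L 0 : ℝ) / r 0) (n : ℕ)
    (hu : (1 - t) * (2 ^ n * Real.log (r 0)) ≤ 1 / 6) :
    ((4 : ℝ) / 3) ^ n * (c * (s - 1)) < 2 := by
  by_contra H
  push Not at H
  have NF := improvable_normalForm r Q L hsum hQ1 hm0 hL hr
  have VF := improvable_virtualForm K r Q L G hsum hQ1 hm0 hL hr hG0 hG hread ht1 hst
  have hu0 : 0 ≤ 1 - t := by linarith
  have hℓ : 0 ≤ Real.log (r 0) := by
    have := (NF 0).1
    exact Real.log_nonneg (by exact_mod_cast (show 0 < r 0 by exact_mod_cast this))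
  -- lower bounds  a_j - b_j ≤ D_j  for j ≤ n,  a_j = (4/3)^j c v,  b_j = 3 u 2^j ℓ
  have P : ∀ j, j ≤ n → ((4 : ℝ) / 3) ^ j * (c * (s - 1)) -
      3 * ((1 - t) * (2 ^ j * Real.log (r 0))) ≤ G j s t / r j - (L j : ℝ) / r j := by
    intro j
    induction j with
    | zero =>
      intro _
      simp only [pow_zero, one_mul]
      have : 0 ≤ 3 * ((1 - t) * (1 * Real.log (r 0))) := by positivity
      linarith
    | succ j ih =>
      intro hj
      have ihj := ih (by omega)
      obtain ⟨hrpos, hmj0, hmj3, hρ, hmrec⟩ := NF j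
      obtain ⟨hθ0, hθρ, hdef, hγ0, hγ1, hγrec⟩ := VF j
      -- a_j - b_j ≥ 0
      have h2j : (2 : ℝ) ^ j * 2 ^ (n - j) = 2 ^ n := by rw [← pow_add, Nat.add_sub_cancel' (by omega)]
      have h43 : ((4 : ℝ) / 3) ^ j * ((4 : ℝ) / 3) ^ (n - j) = ((4 : ℝ) / 3) ^ n := by
        rw [← pow_add, Nat.add_sub_cancel' (by omega)]
      have hA : 2 * ((3 : ℝ) / 4) ^ (n - j) ≤ ((4 : ℝ) / 3) ^ j * (c * (s - 1)) := by
        have hpos : (0 : ℝ) ≤ ((3 : ℝ) / 4) ^ (n - j) := by positivity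
        have e : ((3 : ℝ) / 4) ^ (n - j) * ((4 : ℝ) / 3) ^ (n - j) = 1 := by
          rw [← mul_pow]; norm_num
        calc 2 * ((3 : ℝ) / 4) ^ (n - j) ≤ ((4 : ℝ) / 3) ^ n * (c * (s - 1)) * ((3 : ℝ) / 4) ^ (n - j) := by
              nlinarith
          _ = ((4 : ℝ) / 3) ^ j * (c * (s - 1)) * (((3 : ℝ) / 4) ^ (n - j) * ((4 : ℝ) / 3) ^ (n - j)) := by
              rw [← h43]; ring
          _ = ((4 : ℝ) / 3) ^ j * (c * (s - 1)) := by rw [e, mul_one]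
      have hB : 3 * ((1 - t) * (2 ^ j * Real.log (r 0))) ≤ 1 / 2 * (1 / (2 : ℝ) ^ (n - j)) := by
        have hpos : (0 : ℝ) < 2 ^ (n - j) := by positivity
        rw [show 1 / 2 * (1 / (2 : ℝ) ^ (n - j)) = 1 / 2 / 2 ^ (n - j) by ring, le_div_iff₀ hpos]
        calc 3 * ((1 - t) * (2 ^ j * Real.log (r 0))) * 2 ^ (n - j)
            = 3 * ((1 - t) * (2 ^ j * 2 ^ (n - j) * Real.log (r 0))) := by ring
          _ = 3 * ((1 - t) * (2 ^ n * Real.log (r 0))) := by rw [h2j]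
          _ ≤ 1 / 2 := by linarith
      have hC : 1 / 2 * (1 / (2 : ℝ) ^ (n - j)) ≤ 2 * ((3 : ℝ) / 4) ^ (n - j) := by
        have h1 : (1 / (2 : ℝ)) ^ (n - j) ≤ ((3 : ℝ) / 4) ^ (n - j) :=
          pow_le_pow_left₀ (by norm_num) (by norm_num) _
        rw [one_div_pow] at h1
        have h2 : (0 : ℝ) ≤ 1 / 2 ^ (n - j) := by positivity
        linarith
      have hDj : 0 ≤ G j s t / r j - (L j : ℝ) / r j := by linarith
      have hstep := improvable_deviation_step hmj3 hθρ (by linarith) hγ1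
      rw [← hγrec, ← hmrec] at hstep
      have e43 : ((4 : ℝ) / 3) ^ (j + 1) * (c * (s - 1)) = 4 / 3 * (((4 : ℝ) / 3) ^ j * (c * (s - 1))) := by
        rw [pow_succ]; ring
      have e2 : 3 * ((1 - t) * (2 ^ (j + 1) * Real.log (r 0))) =
          4 / 3 * (3 * ((1 - t) * (2 ^ j * Real.log (r 0)))) + 2 * ((1 - t) * (2 ^ j * Real.log (r 0))) := by
        rw [pow_succ]; ring
      rw [e43, e2]
      nlinarith
  have hfin := P n le_rfl
  obtain ⟨-, hmn0, -, -, -⟩ := NF n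
  obtain ⟨-, -, -, -, hγ1, -⟩ := VF n
  have hb : 3 * ((1 - t) * (2 ^ n * Real.log (r 0))) ≤ 1 / 2 := by linarith
  linarith

end Chain

end Summit.MatrixMultiplication.MatrixMultiplication.Theorems.FarEdgeDescentImprovableDynamics

end
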